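import Literature.AlgebraicGeometry.Deformation.BaseChangeKernelIdeal
import Mathlib.RingTheory.Flat.EquationalCriterion
import Mathlib.RingTheory.LocalRing.ResidueField.Basic
import Mathlib.LinearAlgebra.Dimension.Free
import HarnessLib

/-!
# Coordinates on `J·C` for a flat algebra `C` over a local ring and an ideal `J` killed by the maximal ideal
# ([Hartshorne2010] §6, proof of Thm. 6.2/6.4: «`J ⊗_C A' = J ⊗_k A₀` since `J` is a `k`-vector space»)

Layer `Literature/AlgebraicGeometry/Deformation`, namespace `Literature.AlgebraicGeometry.Deformation`.  THEOREMS ONLY (no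
definition, no named fact, no instance, no notation, no `sorry`).  Cell hodgecm-mathlib (D-0151): brick C3 of the (E)-half of
[MumfordFogartyKirwan1994] Prop. 6.15 (F-11 (A4b) ∕ F-4 II-a-E; sockets B-p01 (g16) `SOCKETS-A4b-FileA-E.v0` §2 C3; hand B-p04 (g22)).
HC_CM is proved only modulo the 7 printed citations until rung 0 closes; nothing here bears on a summit statement.

SETTING ([Hartshorne2010, §6, Notation 6.1 and the proofs of Thm. 6.2 (p. 46) and Thm. 6.4 (p. 50)]): `A` a local ring with maximal
ideal `𝔪` and residue field `k`, `J ⊆ A` an ideal with `𝔪·J = 0` («so that `J` can be considered as a `k`-vector space»), and `C` a FLAT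
`A`-algebra (in the application: the sections of a flat `A`-scheme over an affine open).  Then «`J ⊗_A C = J ⊗_k (C ⧸ 𝔪C)`»: in the
coordinates of a `k`-basis `j₁, …, j_r` of `J`, every element of `J·C` is `∑ j_ρ c_ρ` with the `c_ρ ∈ C` UNIQUE MODULO `𝔪C`.  Recorded def-free:

* §1 `exists_generators_independent_mod_maximalIdeal` — a finitely generated `J` with `𝔪·J = 0` has generators `j : Fin r → J` that are
  «independent modulo `𝔪`»: `∑ a_ρ j_ρ = 0 ⇒ a_ρ ∈ 𝔪` (a `k`-basis of the `k`-vector space `J`, Mathlib `Module.finBasis`);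
* §2 the COORDINATES for a flat `A`-algebra `C`: `mem_map_maximalIdeal_of_sum_mul_eq_zero` (injectivity: `∑ j_ρ c_ρ = 0 ⇒ c_ρ ∈ 𝔪C`,
  Mathlib's equational criterion of flatness `Module.Flat.isTrivialRelation_of_sum_smul_eq_zero`), `exists_eq_sum_mul_of_mem_map`
  (surjectivity onto `J·C`), `sum_mul_eq_sum_mul_of_sub_mem` (well-definedness modulo `𝔪C`, uses `𝔪·J = 0`),
  `sub_mem_map_maximalIdeal_of_sum_mul_eq` (uniqueness modulo `𝔪C`), `map_sum_mul` (naturality in `A`-algebra maps `C → C'`);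
* §3 the SCHEME READING of `C ⧸ 𝔪C`: for a cartesian square `pr : Z̄ = Z ×_A Spec k → Z` and an affine open `U ⊆ Z`,
  `pr^♯_U : Γ(Z, U) → Γ(Z̄, pr⁻¹U)` is surjective with kernel `𝔪·Γ(Z, U)` (★ `ker_app_eq_map_of_isPullback` + Mathlib
  `Scheme.Hom.app_surjective` for the closed immersion `pr`).

## References
* [Hartshorne2010] R. Hartshorne, *Deformation Theory*, GTM 257 (2010), §6: Notation 6.1 (pp. 45–46), proof of Thm. 6.2 (p. 46),
  proof of Thm. 6.4 (p. 50).
* [StacksProject] The Stacks Project, Tag 00HK (equational criterion of flatness).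
-/

noncomputable section

universe u

open CategoryTheory AlgebraicGeometry IsLocalRing

namespace Literature.AlgebraicGeometry.Deformation

/-! ### §1 Generators of `J` independent modulo `𝔪` (a `k`-basis of the `k`-vector space `J`) -/

section Generators

variable {A : Type*} [CommRing A] [IsLocalRing A]

/-- **A finitely generated ideal `J` with `𝔪·J = 0` has generators independent modulo `𝔪`**: there are `j₁, …, j_r ∈ J`
generating `J` with `∑ a_ρ j_ρ = 0 ⇒ a_ρ ∈ 𝔪` — lift a `k`-basis of `J`, which «can be considered as a `k`-vector space»
(Mathlib `Module.IsTorsionBySet.module`, `Module.finBasis`). [cite: Hartshorne2010, §6 Notation 6.1 (pp. 45–46)] -/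
theorem exists_generators_independent_mod_maximalIdeal {J : Ideal A} (hJ : J.FG) (hmJ : maximalIdeal A * J = ⊥) :
    ∃ (r : ℕ) (j : Fin r → A), (∀ ρ, j ρ ∈ J) ∧ J ≤ Ideal.span (Set.range j) ∧
      ∀ a : Fin r → A, ∑ ρ, a ρ * j ρ = 0 → ∀ ρ, a ρ ∈ maximalIdeal A := by
  classical
  -- `J` is killed by `𝔪`, hence a vector space over `k = A ⧸ 𝔪`
  have htors : Module.IsTorsionBySet A J (maximalIdeal A) := by
    rintro x ⟨m, hm⟩
    apply Subtype.ext
    change m * (x : A) = 0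
    have h : m * (x : A) ∈ maximalIdeal A * J := Ideal.mul_mem_mul hm x.2
    rw [hmJ] at h
    exact (Submodule.mem_bot A).1 h
  letI : Field (A ⧸ maximalIdeal A) := Ideal.Quotient.field _
  letI : Module (A ⧸ maximalIdeal A) J := htors.module
  haveI : IsScalarTower A (A ⧸ maximalIdeal A) J := htors.isScalarTower
  haveI : Module.Finite A J := Module.Finite.iff_fg.mpr hJ
  haveI : Module.Finite (A ⧸ maximalIdeal A) J := Module.Finite.of_restrictScalars_finite A _ _
  let b := Module.finBasis (A ⧸ maximalIdeal A) J
  refine ⟨Module.finrank (A ⧸ maximalIdeal A) J, fun ρ => (b ρ : A), fun ρ => (b ρ).2, fun x hx => ?_, fun a ha ρ => ?_⟩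
  · -- generation: lift the coordinates of `x` in the basis `b` to `A`
    choose a ha using fun ρ => Ideal.Quotient.mk_surjective (b.repr ⟨x, hx⟩ ρ)
    have hsum : (⟨x, hx⟩ : J) = ∑ ρ, a ρ • b ρ := by
      conv_lhs => rw [← b.sum_repr ⟨x, hx⟩]
      refine Finset.sum_congr rfl fun ρ _ => ?_
      rw [← ha ρ, Module.IsTorsionBySet.mk_smul]
    have hx' : x = ∑ ρ, a ρ * (b ρ : A) := by
      have h := congrArg Subtype.val hsum
      simpa only [Submodule.coe_sum, Submodule.coe_smul, smul_eq_mul] using h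
    rw [hx']
    exact Ideal.sum_mem _ fun ρ _ => Ideal.mul_mem_left _ _ (Ideal.subset_span ⟨ρ, rfl⟩)
  · -- independence modulo `𝔪`: read the relation in `J` over `k`
    have hsum : ∑ σ, Ideal.Quotient.mk (maximalIdeal A) (a σ) • b σ = 0 := by
      apply Subtype.ext
      have h : ((∑ σ, Ideal.Quotient.mk (maximalIdeal A) (a σ) • b σ : J) : A) = ∑ σ, a σ * (b σ : A) := by
        rw [Submodule.coe_sum]
        refine Finset.sum_congr rfl fun σ _ => ?_
        rw [Module.IsTorsionBySet.mk_smul, Submodule.coe_smul, smul_eq_mul]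
      rw [h, ha]
      rfl
    have h0 := Fintype.linearIndependent_iff.1 b.linearIndependent (fun σ => Ideal.Quotient.mk (maximalIdeal A) (a σ)) hsum ρ
    exact Ideal.Quotient.eq_zero_iff_mem.1 h0

end Generators

/-! ### §2 Coordinates on `J·C` for a flat `A`-algebra `C` -/

section Coordinates

variable {A C : Type*} [CommRing A] [IsLocalRing A] [CommRing C] [Algebra A C] {r : ℕ} (j : Fin r → A)

/-- **Injectivity of the coordinates** (equational criterion of flatness): if `C` is flat over the local ring `A` and the `j_ρ`
are independent modulo `𝔪` (`∑ a_ρ j_ρ = 0 ⇒ a_ρ ∈ 𝔪`), then `∑ j_ρ c_ρ = 0` in `C` forces every `c_ρ ∈ 𝔪·C`.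
[cite: Hartshorne2010, §6 proof of Thm. 6.2 (p. 46)] [cite: StacksProject, Tag 00HK] -/
theorem mem_map_maximalIdeal_of_sum_mul_eq_zero [Module.Flat A C]
    (hind : ∀ a : Fin r → A, ∑ ρ, a ρ * j ρ = 0 → ∀ ρ, a ρ ∈ maximalIdeal A)
    {c : Fin r → C} (hc : ∑ ρ, algebraMap A C (j ρ) * c ρ = 0) (ρ : Fin r) :
    c ρ ∈ (maximalIdeal A).map (algebraMap A C) := by
  have hc' : ∑ ρ, j ρ • c ρ = 0 := by simpa only [Algebra.smul_def] using hc
  obtain ⟨n, a, y, h1, h2⟩ := Module.Flat.isTrivialRelation_of_sum_smul_eq_zero (R := A) (M := C) hc'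
  rw [h1 ρ]
  refine Ideal.sum_mem _ fun t _ => ?_
  rw [Algebra.smul_def]
  refine Ideal.mul_mem_right _ _ (Ideal.mem_map_of_mem _ ?_)
  refine hind (fun σ => a σ t) ?_ ρ
  rw [← h2 t]
  exact Finset.sum_congr rfl fun σ _ => mul_comm _ _

omit [IsLocalRing A] in
/-- **Surjectivity of the coordinates**: if the `j_ρ` generate `J`, every element of `J·C` is `∑ j_ρ c_ρ`.
[cite: Hartshorne2010, §6 proof of Thm. 6.4 (p. 50)] -/
theorem exists_eq_sum_mul_of_mem_map {J : Ideal A} (hspan : J ≤ Ideal.span (Set.range j)) {x : C}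
    (hx : x ∈ J.map (algebraMap A C)) : ∃ c : Fin r → C, x = ∑ ρ, algebraMap A C (j ρ) * c ρ := by
  have hx' : x ∈ Ideal.span (Set.range (fun ρ => algebraMap A C (j ρ))) := by
    have h := Ideal.map_mono (f := algebraMap A C) hspan hx
    rwa [Ideal.map_span, ← Set.range_comp] at h
  obtain ⟨c, hc⟩ := Ideal.mem_span_range_iff_exists_fun.1 hx'
  exact ⟨c, by rw [← hc]; exact Finset.sum_congr rfl fun ρ _ => mul_comm _ _⟩

omit [IsLocalRing A] in
/-- Conversely `∑ j_ρ c_ρ ∈ J·C` when the `j_ρ` lie in `J`. [cite: Hartshorne2010, §6 proof of Thm. 6.4 (p. 50)] -/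
theorem sum_mul_mem_map {J : Ideal A} (hj : ∀ ρ, j ρ ∈ J) (c : Fin r → C) :
    ∑ ρ, algebraMap A C (j ρ) * c ρ ∈ J.map (algebraMap A C) :=
  Ideal.sum_mem _ fun ρ _ => Ideal.mul_mem_right _ _ (Ideal.mem_map_of_mem _ (hj ρ))

omit [IsLocalRing A] in
/-- `φ(η) · c = 0` for `c ∈ I·C` when `η` kills `I` (as ★ `SmallExtensionKernelSections.mul_eq_zero_of_mem_map_of_forall_mul_eq_zero`).
[cite: Hartshorne2010, §6 Notation 6.1 (pp. 45–46)] -/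
private theorem mul_eq_zero_of_mem_map {I : Ideal A} {η : A} (hI : ∀ m ∈ I, η * m = 0) {c : C}
    (hc : c ∈ I.map (algebraMap A C)) : algebraMap A C η * c = 0 := by
  rw [Ideal.map] at hc
  refine Submodule.span_induction (p := fun x _ => algebraMap A C η * x = 0) ?_ ?_ ?_ ?_ hc
  · rintro x ⟨m, hm, rfl⟩
    rw [← map_mul, hI m hm, map_zero]
  · exact mul_zero _
  · intro x y _ _ hx hy
    rw [mul_add, hx, hy, add_zero]
  · intro a x _ hx
    rw [smul_eq_mul, mul_left_comm, hx, mul_zero]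

/-- **The coordinates only depend on the classes modulo `𝔪C`** (`𝔪·J = 0`): if `c_ρ − c'_ρ ∈ 𝔪·C` then `∑ j_ρ c_ρ = ∑ j_ρ c'_ρ`.
[cite: Hartshorne2010, §6 Notation 6.1 (pp. 45–46), «`𝔪_{C'} J = 0`»] -/
theorem sum_mul_eq_sum_mul_of_sub_mem {J : Ideal A} (hj : ∀ ρ, j ρ ∈ J) (hmJ : maximalIdeal A * J = ⊥)
    {c c' : Fin r → C} (h : ∀ ρ, c ρ - c' ρ ∈ (maximalIdeal A).map (algebraMap A C)) :
    ∑ ρ, algebraMap A C (j ρ) * c ρ = ∑ ρ, algebraMap A C (j ρ) * c' ρ := by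
  rw [← sub_eq_zero, ← Finset.sum_sub_distrib]
  refine Finset.sum_eq_zero fun ρ _ => ?_
  rw [← mul_sub]
  refine mul_eq_zero_of_mem_map (fun m hm => ?_) (h ρ)
  have : m * j ρ ∈ maximalIdeal A * J := Ideal.mul_mem_mul hm (hj ρ)
  rw [hmJ] at this
  rw [mul_comm]
  exact (Submodule.mem_bot A).1 this

/-- **Uniqueness of the coordinates modulo `𝔪C`** (flatness): two coordinate vectors of the same element differ by elements of
`𝔪·C`. [cite: Hartshorne2010, §6 proof of Thm. 6.2 (p. 46)] -/
theorem sub_mem_map_maximalIdeal_of_sum_mul_eq [Module.Flat A C]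
    (hind : ∀ a : Fin r → A, ∑ ρ, a ρ * j ρ = 0 → ∀ ρ, a ρ ∈ maximalIdeal A)
    {c c' : Fin r → C} (h : ∑ ρ, algebraMap A C (j ρ) * c ρ = ∑ ρ, algebraMap A C (j ρ) * c' ρ) (ρ : Fin r) :
    c ρ - c' ρ ∈ (maximalIdeal A).map (algebraMap A C) := by
  refine mem_map_maximalIdeal_of_sum_mul_eq_zero j hind (c := fun ρ => c ρ - c' ρ) ?_ ρ
  simp only [mul_sub, Finset.sum_sub_distrib, h, sub_self]

omit [IsLocalRing A] in
/-- **Naturality of the coordinates** in `A`-algebra maps `u : C → C'`: `u (∑ j_ρ c_ρ) = ∑ j_ρ u(c_ρ)`.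
[cite: Hartshorne2010, §6 proof of Thm. 6.4 (p. 50)] -/
theorem map_sum_mul {C' : Type*} [CommRing C'] [Algebra A C'] (u : C →ₐ[A] C') (c : Fin r → C) :
    u (∑ ρ, algebraMap A C (j ρ) * c ρ) = ∑ ρ, algebraMap A C' (j ρ) * u (c ρ) := by
  rw [map_sum]
  exact Finset.sum_congr rfl fun ρ _ => by rw [map_mul, AlgHom.commutes]

omit [IsLocalRing A] in
/-- Naturality for a plain ring map commuting with the structure maps. [cite: Hartshorne2010, §6 proof of Thm. 6.4 (p. 50)] -/
theorem map_sum_mul' {C' : Type*} [CommRing C'] [Algebra A C'] (u : C →+* C')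
    (hu : ∀ a, u (algebraMap A C a) = algebraMap A C' a) (c : Fin r → C) :
    u (∑ ρ, algebraMap A C (j ρ) * c ρ) = ∑ ρ, algebraMap A C' (j ρ) * u (c ρ) := by
  rw [map_sum]
  exact Finset.sum_congr rfl fun ρ _ => by rw [map_mul, hu]

/-- `A`-algebra maps preserve `𝔪·C`: `u (𝔪·C) ⊆ 𝔪·C'` (so coordinates modulo `𝔪` are natural).
[cite: Hartshorne2010, §6 proof of Thm. 6.4 (p. 50)] -/
theorem map_mem_map_maximalIdeal {C' : Type*} [CommRing C'] [Algebra A C'] (u : C →+* C')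
    (hu : ∀ a, u (algebraMap A C a) = algebraMap A C' a) {x : C} (hx : x ∈ (maximalIdeal A).map (algebraMap A C)) :
    u x ∈ (maximalIdeal A).map (algebraMap A C') := by
  have h : (maximalIdeal A).map (u.comp (algebraMap A C)) = (maximalIdeal A).map (algebraMap A C') := by
    congr 1; exact RingHom.ext hu
  rw [← h, ← Ideal.map_map]
  exact Ideal.mem_map_of_mem u hx

end Coordinates

/-! ### §3 The scheme reading of `C ⧸ 𝔪C`: sections of the closed fibre over an affine open -/

section ClosedFibre

variable {A : Type u} [CommRing A] [IsLocalRing A] {Z Zk : Scheme.{u}} {q : Z ⟶ Spec (.of A)}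
  {pr : Zk ⟶ Z} {qk : Zk ⟶ Spec (.of (ResidueField A))}

/-- **`Γ(Z̄, pr⁻¹U) = Γ(Z, U) ⧸ 𝔪·Γ(Z, U)`** for the closed fibre `pr : Z̄ = Z ×_A Spec k → Z` of an `A`-scheme and an affine
open `U ⊆ Z`: `pr^♯_U` is surjective (a closed immersion, Mathlib `Scheme.Hom.app_surjective`) with kernel `𝔪·Γ(Z, U)`
(★ `ker_app_eq_map_of_isPullback`).  [cite: Hartshorne2010, §6 proof of Thm. 6.4 (p. 50)] -/
theorem app_surjective_and_ker_eq_of_isPullback_residue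
    (H : IsPullback pr qk q (Spec.map (CommRingCat.ofHom (residue A)))) (U : Z.affineOpens) :
    Function.Surjective (pr.app U.1) ∧
      RingHom.ker (pr.app U.1).hom =
        (maximalIdeal A).map ((Z.presheaf.map (homOfLE (le_top : U.1 ≤ ⊤)).op).hom.comp (specStructureMap q)) := by
  haveI : IsClosedImmersion pr :=
    MorphismProperty.of_isPullback H.flip (IsClosedImmersion.spec_of_surjective _ residue_surjective)
  refine ⟨pr.app_surjective U.1 U.2, ?_⟩
  rw [← ker_residue]
  exact ker_app_eq_map_of_isPullback (residue A) residue_surjective H U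

end ClosedFibre

end Literature.AlgebraicGeometry.Deformation

end
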